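/-
Copyright (c) 2026 the pub-hodgecm-mathlib formalisation cell (harness21).  Prover seat hodgecm-mathlib-LH4-p12 (g3), Track A «(D-RAM) FOUR-FRAME», unit U2H, the census leaf
(ρ2b′-X) — PAYER-PLAN-rho2bX v1 brick T1 «norm-residue glue counts», the VALUES at and above the conductor.  2026-09-04.
-/
import Literature.NumberTheory.LocalFields.WildQuadraticDatumNormFibreValues   -- ★ (this seat): the layer partition, `#Sol_{2a}(1) = q^a` below the conductor
import Literature.NumberTheory.LocalFields.WildQuadraticDatumUnitNormIndexTwo   -- ★ `exists_unit_norm_dichotomy_of_isRamifiedQuadraticDatum` (unit norm index two)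
import Literature.NumberTheory.LocalFields.ValuedCompleteIsAdicComplete       -- ★ `isAdicComplete_valuedInteger_of_completeSpace`
import HarnessLib

/-!
# Norm fibres of a WILD ramified quadratic datum, III: the break layer and the VALUES `2q^a` at and above the conductor
# (Serre, *Local Fields* V §3 Cor. 3: `[U_F : N U_E] = 2`, conductor `d`; Labesse–Langlands 1979 §2 «`δ_m = 2q^m`»)

Topic `NumberTheory/LocalFields`; namespace `Literature.NumberTheory.LocalFields.WildQuadraticDatum`.  THEOREMS ONLY (no definition, no instance, no notation, no named fact, no
`sorry`); kernel lane `--supports stmt-HodgeConjecture-24833` (count-neutral).  Cell `pub/hodgecm-mathlib` (D-0151), crux H413, Track A «(D-RAM) FOUR-FRAME», unit U2H, census leaf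
(ρ2b′-X): third (last) part of PAYER-PLAN-rho2bX v1 brick T1 — the glue count `A(a, ξ)` of the toric∕order reduction AT AND ABOVE the conductor (LH4-p12 (g3)).
With `Sol_n(r)`, `G_a` as in ★ Parts I–II:
* §1 **THE BREAK LAYER** (`a = d − 1 ≥ 1`, `K` complete): `2 · #Sol_{2(d−1)}(1) = q · #G_{d−1}` — in the layer partition (★ `exists_layer_partition`) a block is a translate of `G_{d−1}`
  when its representative `w_c` is a norm and EMPTY otherwise (a solution would make `w_c` a norm by the conductor ★ `exists_mul_map_eq_of_fixed_of_v_sub_one_le_pred`), the norm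
  classes form a subgroup of `(𝓀, +)` of index `2` (additivity of the representatives, norms multiply, the unit norm index is two ★ `exists_unit_norm_dichotomy_…`, and a non-norm
  sits in the layer ★ `exists_fixed_unit_not_norm_v_sub_one_le`), so exactly `q∕2` blocks are non-empty;
* §2 **THE VALUES AT AND ABOVE THE CONDUCTOR**: `#Sol_{2a}(1) = 2·q^a` for every `a ≥ d` (★ values below, ★ lifting step, full layers above the conductor);
* §3 **THE NORM-GATED GLUE COUNT**: for `a ≥ d` and a fixed unit `r`, `#Sol_{2a}(r) = 2·q^a` if `r ∈ N(Kˣ)` and `= 0` otherwise (two theorems; ★ Part I §4) — the value `A(a, ξ) = 2q^a·[ξ ∈ N]` of the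
  wild toric census (model: LH4-p12 (g3) `toric_census.v1`, `glue_A_bruteforce`, 9 wild cells).
HONEST LABEL: HC_CM is proved only modulo the 7 printed citations (2 remaining named inputs: hLiu418 = stmt-HodgeConjecture-24832, h413 = stmt-HodgeConjecture-24833) until rung 0
closes; unconditional local algebra, count-neutral.

## References
* [Serre1979] J.-P. Serre, *Local Fields*, GTM 67 (1979): Ch. V §3 Prop. 5, Cor. 2–3 pp. 84–86 (the norm index and conductor of a totally ramified cyclic extension of prime
  degree), Ch. XV §2.
* [LabesseLanglands1979] J.-P. Labesse, R. P. Langlands, *L-indistinguishability for SL(2)*, Canad. J. Math. 31 (1979), §2 p. 8.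
-/

set_option autoImplicit false

noncomputable section

open WithZero IsLocalRing
open scoped Valued
open Literature.NumberTheory.Automorphic.UnitaryThreeFourFrame

namespace Literature.NumberTheory.LocalFields.WildQuadraticDatum

variable {K : Type} [Field K] [Valued K ℤᵐ⁰] {σ : K →+* K} {ϖ : K} {d t : ℕ}

/-! ## §0 Norm bookkeeping -/

/-- A fixed unit `≡` a norm to order `2d − 1` IS a norm: if `|zσz − w| ≤ |ϖ^n|` with `2d − 1 ≤ n`, `z` a unit and `w` fixed, then `w ∈ N(Kˣ)` (`K` complete).
[cite: Serre1979, Ch. V §3 Cor. 3, Ch. XV §2] -/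
theorem exists_mul_map_eq_of_approx [CompleteSpace K] (hD : IsRamifiedQuadraticDatum σ ϖ d t) {w z : K} (hσw : σ w = w) (hz : Valued.v z = 1)
    {n : ℕ} (hn : 2 * d - 1 ≤ n) (h : Valued.v (z * σ z - w) ≤ Valued.v (ϖ ^ n)) : ∃ y : K, y * σ y = w := by
  have hσ := hD.1; have hvσ := hD.2.1
  have hN1 : Valued.v (z * σ z) = 1 := by rw [map_mul, hvσ, hz, mul_one]
  have hN0 : z * σ z ≠ 0 := (Valuation.ne_zero_iff _).1 (by rw [hN1]; exact one_ne_zero)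
  set u : K := w / (z * σ z) with hu
  have hσu : σ u = u := by rw [hu, map_div₀, hσw, map_mul_map hσ]
  have hu1 : Valued.v (u - 1) ≤ Valued.v ϖ ^ n := by
    rw [hu, div_sub_one hN0, map_div₀, hN1, div_one, Valuation.map_sub_swap, ← map_pow]; exact h
  obtain ⟨y, hy⟩ := exists_mul_map_eq_of_fixed_of_v_sub_one_le_pred hD hσu hn hu1
  refine ⟨y * z, ?_⟩
  calc y * z * σ (y * z) = (y * σ y) * (z * σ z) := by rw [map_mul]; ring
    _ = u * (z * σ z) := by rw [hy]
    _ = w := div_mul_cancel₀ w hN0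

/-- Norm classes of fixed units multiply: with the unit norm index two (★ dichotomy element `c₀`), `w·w′ ∈ N ↔ (w ∈ N ↔ w′ ∈ N)` for fixed units `w, w′`.
[cite: Serre1979, Ch. V §3 Cor. 3] -/
theorem exists_mul_map_eq_mul_iff {c₀ : K} (hσc₀ : σ c₀ = c₀) (hc₀ : Valued.v c₀ = 1)
    (hdich : ∀ u : K, σ u = u → Valued.v u = 1 → (∃ z : K, z * σ z = u) ∨ ∃ z : K, z * σ z = c₀ * u)
    {w w' : K} (hσw : σ w = w) (hw : Valued.v w = 1) (hσw' : σ w' = w') (hw' : Valued.v w' = 1) :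
    (∃ z : K, z * σ z = w * w') ↔ ((∃ z : K, z * σ z = w) ↔ ∃ z : K, z * σ z = w') := by
  have hw0 : w ≠ 0 := (Valuation.ne_zero_iff _).1 (by rw [hw]; exact one_ne_zero)
  have hw'0 : w' ≠ 0 := (Valuation.ne_zero_iff _).1 (by rw [hw']; exact one_ne_zero)
  have hc₀0 : c₀ ≠ 0 := (Valuation.ne_zero_iff _).1 (by rw [hc₀]; exact one_ne_zero)
  -- quotients and products of norms are norms
  have hdiv : ∀ {a b : K}, b ≠ 0 → (∃ z : K, z * σ z = a) → (∃ z : K, z * σ z = b) → ∃ z : K, z * σ z = a / b := by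
    rintro a b hb ⟨x, hx⟩ ⟨y, hy⟩
    refine ⟨x / y, ?_⟩
    rw [map_div₀, div_mul_div_comm, hx, hy]
  have hmul : ∀ {a b : K}, (∃ z : K, z * σ z = a) → (∃ z : K, z * σ z = b) → ∃ z : K, z * σ z = a * b := by
    rintro a b ⟨x, hx⟩ ⟨y, hy⟩; exact ⟨x * y, by rw [← mul_map_mul_map, hx, hy]⟩
  constructor
  · intro hww'
    constructor
    · intro hwN
      have := hdiv hw0 hww' hwN
      rwa [mul_div_cancel_left₀ _ hw0] at this
    · intro hw'N
      have := hdiv hw'0 hww' hw'N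
      rwa [mul_div_cancel_right₀ _ hw'0] at this
  · intro hiff
    by_cases hwN : ∃ z : K, z * σ z = w
    · exact hmul hwN (hiff.1 hwN)
    · have hw'N : ¬ ∃ z : K, z * σ z = w' := fun h => hwN (hiff.2 h)
      obtain ⟨x, hx⟩ := (hdich w hσw hw).resolve_left hwN
      obtain ⟨y, hy⟩ := (hdich w' hσw' hw').resolve_left hw'N
      have hprod : ∃ z : K, z * σ z = (c₀ * w) * (c₀ * w') := hmul ⟨x, hx⟩ ⟨y, hy⟩
      have hc₀sq : ∃ z : K, z * σ z = c₀ * c₀ := ⟨c₀, by rw [hσc₀]⟩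
      have := hdiv (mul_ne_zero hc₀0 hc₀0) hprod hc₀sq
      rwa [show c₀ * w * (c₀ * w') / (c₀ * c₀) = w * w' by field_simp] at this

/-! ## §1 The break layer `a = d − 1` -/

/-- **THE BREAK LAYER: exactly half of the blocks are non-empty.**  At a wild place with `K` complete and `a = d − 1 ≥ 1`:
`2 · #Sol_{2(d−1)}(1) = q · #G_{d−1}`.  In the layer partition (★ `exists_layer_partition`) the block of `c` is a translate of `G_{d−1}` if `w_c ∈ N(Kˣ)` and EMPTY otherwise
(a solution makes `w_c` a norm modulo `𝓂^{2d}`, hence a norm by the conductor); `c ↦ [w_c ∈ N]` is additive (representatives are additive to tolerance `𝓂^{2d}`, norms multiply,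
the unit norm index is two), non-trivial (a non-norm sits in `U_F(2d − 2)`), so its kernel has exactly `q∕2` elements.
[cite: Serre1979, Ch. V §3 Prop. 5, Cor. 2–3 pp. 84–86] [cite: LabesseLanglands1979, §2 p. 8] -/
theorem two_mul_natCard_normFibre_one_at_break [CompleteSpace K] [IsDiscreteValuationRing 𝒪[K]] [Finite 𝓀[K]]
    (hD : IsRamifiedQuadraticDatum σ ϖ d t) (h2v : Valued.v (2 : K) < 1) :
    2 * Nat.card {x : 𝒪[K] ⧸ 𝓂[K] ^ (2 * (d - 1)) // ∃ u : 𝒪[K], Ideal.Quotient.mk (𝓂[K] ^ (2 * (d - 1))) u = x ∧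
        Valued.v ((u : K) * σ u - 1) ≤ Valued.v (ϖ ^ (2 * (d - 1)))} =
      Nat.card 𝓀[K] *
        Nat.card {x : 𝒪[K] ⧸ 𝓂[K] ^ (2 * (d - 1)) // ∃ u : 𝒪[K], Ideal.Quotient.mk (𝓂[K] ^ (2 * (d - 1))) u = x ∧
          Valued.v ((u : K) * σ u - 1) ≤ Valued.v (ϖ ^ (2 * (d - 1) + 2))} := by
  classical
  obtain ⟨hσ, hvσ, hϖ, hfix, hd, hd1, ht⟩ := id hD
  haveI : Fintype 𝓀[K] := Fintype.ofFinite _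
  haveI := Literature.NumberTheory.LocalFields.isAdicComplete_valuedInteger_of_completeSpace hϖ
  have h2d : 2 ≤ d := two_le_of_v_two_lt_one hσ hvσ hfix hϖ hd ht h2v
  have ha : 1 ≤ d - 1 := by omega
  have h2a2 : 2 * (d - 1) + 2 = 2 * d := by omega
  have hϖ1 : Valued.v ϖ < 1 := by rw [hϖ, ← exp_zero, exp_lt_exp]; norm_num
  obtain ⟨w, hwfix, hwone, hwadd, hwcomplete, hsum⟩ := exists_layer_partition hD h2v ha
  -- the unit norm index two
  obtain ⟨c₀, hσc₀, hc₀1, hdich⟩ := exists_unit_norm_dichotomy_of_isRamifiedQuadraticDatum σ ϖ d t hD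
  -- the representatives are units
  have hwunit : ∀ c, Valued.v (w c) = 1 := fun c => by
    have hlt : Valued.v (w c - 1) < Valued.v (1 : K) := by
      rw [map_one]; exact (hwone c).trans_lt (v_varpi_pow_lt_one hϖ (by omega))
    have := Valuation.map_eq_of_sub_lt Valued.v hlt; rwa [map_one] at this
  -- the norm predicate on residues and its blocks
  let Nm : 𝓀[K] → Prop := fun c => ∃ z : K, z * σ z = w c
  set G := Nat.card {x : 𝒪[K] ⧸ 𝓂[K] ^ (2 * (d - 1)) // ∃ u : 𝒪[K], Ideal.Quotient.mk (𝓂[K] ^ (2 * (d - 1))) u = x ∧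
      Valued.v ((u : K) * σ u - 1) ≤ Valued.v (ϖ ^ (2 * (d - 1) + 2))} with hG
  have hblock : ∀ c, Nat.card {x : 𝒪[K] ⧸ 𝓂[K] ^ (2 * (d - 1)) // ∃ u : 𝒪[K], Ideal.Quotient.mk (𝓂[K] ^ (2 * (d - 1))) u = x ∧
      Valued.v ((u : K) * σ u - w c) ≤ Valued.v (ϖ ^ (2 * (d - 1) + 2))} = if Nm c then G else 0 := by
    intro c
    split_ifs with hN
    · obtain ⟨z, hz⟩ := hN
      have hz1 : Valued.v z = 1 := v_eq_one_of_v_mul_map_eq_one hvσ (by rw [hz, hwunit])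
      rw [hG]; symm
      exact natCard_normFibre_eq_of_approx' hvσ (2 * (d - 1)) (2 * (d - 1) + 2) hz1 (by rw [mul_one, hz, sub_self, map_zero]; exact zero_le)
    · haveI : IsEmpty {x : 𝒪[K] ⧸ 𝓂[K] ^ (2 * (d - 1)) // ∃ u : 𝒪[K], Ideal.Quotient.mk (𝓂[K] ^ (2 * (d - 1))) u = x ∧
          Valued.v ((u : K) * σ u - w c) ≤ Valued.v (ϖ ^ (2 * (d - 1) + 2))} := by
        refine ⟨fun ⟨x, u, hux, hc⟩ => hN ?_⟩
        have hlt : Valued.v ((u : K) * σ u - w c) < Valued.v (w c) := by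
          rw [hwunit]; exact hc.trans_lt (v_varpi_pow_lt_one hϖ (by omega))
        have hNu : Valued.v ((u : K) * σ u) = 1 := by rw [← hwunit c]; exact Valuation.map_eq_of_sub_lt _ hlt
        exact exists_mul_map_eq_of_approx hD (hwfix c) (v_eq_one_of_v_mul_map_eq_one hvσ hNu) (n := 2 * (d - 1) + 2) (by omega) hc
      exact Nat.card_of_isEmpty
  -- additivity of the norm predicate
  have hNm_add : ∀ c c', Nm (c + c') ↔ (Nm c ↔ Nm c') := by
    intro c c'
    have hmul_iff := exists_mul_map_eq_mul_iff hσc₀ hc₀1 hdich (hwfix c) (hwunit c) (hwfix c') (hwunit c')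
    rw [← hmul_iff]
    -- `w c · w c′ ≡ w (c + c′)` to order `2d`, so they have the same norm class
    have hq : ∀ {p s : K}, σ p = p → Valued.v p = 1 → σ s = s → Valued.v s = 1 → Valued.v (p - s) ≤ Valued.v (ϖ ^ (2 * (d - 1) + 2)) →
        ((∃ z : K, z * σ z = p) ↔ ∃ z : K, z * σ z = s) := by
      intro p s hσp hp hσs hs hps
      have hs0 : s ≠ 0 := (Valuation.ne_zero_iff _).1 (by rw [hs]; exact one_ne_zero)
      have hp0 : p ≠ 0 := (Valuation.ne_zero_iff _).1 (by rw [hp]; exact one_ne_zero)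
      -- `p∕s` is a norm (conductor)
      have hquot : ∃ z : K, z * σ z = p / s := by
        have hσps : σ (p / s) = p / s := by rw [map_div₀, hσp, hσs]
        have h1 : Valued.v (p / s - 1) ≤ Valued.v ϖ ^ (2 * (d - 1) + 2) := by
          rw [div_sub_one hs0, map_div₀, hs, div_one, ← map_pow]; exact hps
        exact exists_mul_map_eq_of_fixed_of_v_sub_one_le_pred hD hσps (by omega) h1
      constructor
      · rintro ⟨x, hx⟩
        obtain ⟨y, hy⟩ := hquot
        refine ⟨x / y, ?_⟩
        rw [map_div₀, div_mul_div_comm, hx, hy]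
        field_simp
      · rintro ⟨x, hx⟩
        obtain ⟨y, hy⟩ := hquot
        exact ⟨y * x, by rw [← mul_map_mul_map, hy, hx, div_mul_cancel₀ p hs0]⟩
    symm
    exact hq (by rw [map_mul, hwfix, hwfix]) (by rw [map_mul, hwunit, hwunit, mul_one]) (hwfix _) (hwunit _) (hwadd c c')
  -- a non-norm class exists
  have hNm_nontriv : ∃ c₁, ¬ Nm c₁ := by
    obtain ⟨n₀, hσn₀, hn₀1, hn₀, hn₀N⟩ := exists_fixed_unit_not_norm_v_sub_one_le hD h2v
    have hn₀' : Valued.v (n₀ - 1) ≤ Valued.v (ϖ ^ (2 * (d - 1))) := by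
      rw [map_pow, v_varpi_pow hϖ]; refine hn₀.trans ?_; rw [exp_le_exp]; omega
    obtain ⟨c₁, hc₁⟩ := hwcomplete n₀ hσn₀ hn₀'
    refine ⟨c₁, fun hN => hn₀N ?_⟩
    obtain ⟨z, hz⟩ := hN
    have hz1 : Valued.v z = 1 := v_eq_one_of_v_mul_map_eq_one hvσ (by rw [hz, hwunit])
    exact exists_mul_map_eq_of_approx hD hσn₀ hz1 (n := 2 * (d - 1) + 2) (by omega) (by rw [hz, Valuation.map_sub_swap]; exact hc₁)
  obtain ⟨c₁, hc₁⟩ := hNm_nontriv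
  -- exactly half of the classes are norm classes: `c ↦ c + c₁` swaps norm and non-norm classes
  have hcount : 2 * (Finset.univ.filter fun c => Nm c).card = Fintype.card 𝓀[K] := by
    have hbij : (Finset.univ.filter fun c => Nm c).card = (Finset.univ.filter fun c => ¬ Nm c).card := by
      refine Finset.card_bij (fun c _ => c + c₁) (fun c hc => ?_) (fun c hc c' hc' h => add_right_cancel h) (fun c' hc' => ?_)
      · rw [Finset.mem_filter] at hc ⊢
        exact ⟨Finset.mem_univ _, fun hN => hc₁ ((hNm_add c c₁).1 hN |>.1 hc.2)⟩
      · rw [Finset.mem_filter] at hc'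
        refine ⟨c' - c₁, ?_, sub_add_cancel c' c₁⟩
        rw [Finset.mem_filter]
        refine ⟨Finset.mem_univ _, ?_⟩
        by_contra hN'
        -- `c′ = (c′ − c₁) + c₁` with both summands non-norm ⇒ `c′` is a norm class
        have := (hNm_add (c' - c₁) c₁).2 ⟨fun h => absurd h hN', fun h => absurd h hc₁⟩
        rw [sub_add_cancel] at this
        exact hc'.2 this
    have hAB := Finset.card_filter_add_card_filter_not (s := (Finset.univ : Finset 𝓀[K])) (fun c => Nm c)
    rw [Finset.card_univ] at hAB
    omega
  -- assemble
  rw [hsum, finsum_eq_sum_of_fintype, Finset.sum_congr rfl fun c _ => hblock c, Finset.sum_ite, Finset.sum_const_zero, add_zero,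
    Finset.sum_const, smul_eq_mul, ← mul_assoc, hcount, ← Nat.card_eq_fintype_card]

/-! ## §2 The values at and above the conductor -/

/-- **ABOVE THE CONDUCTOR THE LAYER IS FULL**: for `d ≤ a` every fixed `w ≡ 1 (mod 𝓂^{2a})` is an exact norm (conductor), so `#Sol_{2a}(1) = q · #G_a` (`K` complete).
[cite: Serre1979, Ch. V §3 Cor. 3, Ch. XV §2] -/
theorem natCard_normFibre_one_eq_card_mul_of_le [CompleteSpace K] [IsDiscreteValuationRing 𝒪[K]] [Finite 𝓀[K]] (hD : IsRamifiedQuadraticDatum σ ϖ d t)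
    (h2v : Valued.v (2 : K) < 1) {a : ℕ} (hda : d ≤ a) :
    Nat.card {x : 𝒪[K] ⧸ 𝓂[K] ^ (2 * a) // ∃ u : 𝒪[K], Ideal.Quotient.mk (𝓂[K] ^ (2 * a)) u = x ∧ Valued.v ((u : K) * σ u - 1) ≤ Valued.v (ϖ ^ (2 * a))} =
      Nat.card 𝓀[K] *
        Nat.card {x : 𝒪[K] ⧸ 𝓂[K] ^ (2 * a) // ∃ u : 𝒪[K], Ideal.Quotient.mk (𝓂[K] ^ (2 * a)) u = x ∧ Valued.v ((u : K) * σ u - 1) ≤ Valued.v (ϖ ^ (2 * a + 2))} := by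
  have hvσ := hD.2.1; have hϖ := hD.2.2.1; have hd1 := hD.2.2.2.2.2.1
  refine natCard_normFibre_one_eq_card_mul_of_layer hD h2v (by omega) fun w hσw hw1 => ?_
  have hw1' : Valued.v (w - 1) ≤ Valued.v ϖ ^ (2 * a) := by rw [← map_pow]; exact hw1
  obtain ⟨z, hz⟩ := exists_mul_map_eq_of_fixed_of_v_sub_one_le_pred hD hσw (by omega) hw1'
  have hlt : Valued.v (w - 1) < Valued.v (1 : K) := by rw [map_one]; exact hw1.trans_lt (v_varpi_pow_lt_one hϖ (by omega))
  have hw : Valued.v w = 1 := by have := Valuation.map_eq_of_sub_lt Valued.v hlt; rwa [map_one] at this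
  exact ⟨z, v_eq_one_of_v_mul_map_eq_one hvσ (by rw [hz, hw]), by rw [hz, sub_self, map_zero]; exact zero_le⟩

/-- **THE VALUES AT AND ABOVE THE CONDUCTOR: `#Sol_{2a}(1) = 2·q^a` for every `a ≥ d`** (`K` complete, wild place): the break layer (§1) with ★ `#Sol_{2(d−1)}(1) = q^{d−1}` and the
★ lifting step give `#Sol_{2d}(1) = 2q^d`; above the conductor the layers are full (§2), so each further step multiplies by `q`.
[cite: Serre1979, Ch. V §3 Prop. 5, Cor. 2–3 pp. 84–86] [cite: LabesseLanglands1979, §2 p. 8] -/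
theorem natCard_normFibre_one_eq_two_mul_pow [CompleteSpace K] [IsDiscreteValuationRing 𝒪[K]] [Finite 𝓀[K]] (hD : IsRamifiedQuadraticDatum σ ϖ d t)
    (h2v : Valued.v (2 : K) < 1) {a : ℕ} (hda : d ≤ a) :
    Nat.card {x : 𝒪[K] ⧸ 𝓂[K] ^ (2 * a) // ∃ u : 𝒪[K], Ideal.Quotient.mk (𝓂[K] ^ (2 * a)) u = x ∧ Valued.v ((u : K) * σ u - 1) ≤ Valued.v (ϖ ^ (2 * a))} =
      2 * Nat.card 𝓀[K] ^ a := by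
  obtain ⟨hσ, hvσ, hϖ, hfix, hd, hd1, ht⟩ := id hD
  have h2d : 2 ≤ d := two_le_of_v_two_lt_one hσ hvσ hfix hϖ hd ht h2v
  induction a, hda using Nat.le_induction with
  | base =>
    -- `#Sol_{2d}(1) = q² #G_{d−1}`, `2 #Sol_{2(d−1)}(1) = q #G_{d−1}`, `#Sol_{2(d−1)}(1) = q^{d−1}`
    have hstep := natCard_normFibre_one_succ hD h2v (a := d - 1) (by omega)
    have hbreak := two_mul_natCard_normFibre_one_at_break hD h2v
    have hbelow := natCard_normFibre_one_eq_pow hD h2v (a := d - 1) (by omega) (by omega)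
    rw [hbelow] at hbreak
    rw [show 2 * (d - 1) + 2 = 2 * d by omega] at hstep hbreak
    rw [hstep]
    set G := Nat.card {x : 𝒪[K] ⧸ 𝓂[K] ^ (2 * (d - 1)) // ∃ u : 𝒪[K], Ideal.Quotient.mk (𝓂[K] ^ (2 * (d - 1))) u = x ∧
      Valued.v ((u : K) * σ u - 1) ≤ Valued.v (ϖ ^ (2 * d))} with hG
    set q := Nat.card 𝓀[K] with hq
    have hd' : q ^ d = q ^ (d - 1) * q := by
      rw [← pow_succ]; congr 1; omega
    calc q ^ 2 * G = q * (q * G) := by ring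
      _ = q * (2 * q ^ (d - 1)) := by rw [← hbreak]
      _ = 2 * q ^ d := by rw [hd']; ring
  | succ a hda ih =>
    have hstep := natCard_normFibre_one_succ hD h2v (a := a) (by omega)
    have hlayer := natCard_normFibre_one_eq_card_mul_of_le hD h2v hda
    rw [show 2 * (a + 1) = 2 * a + 2 by ring, hstep, pow_two, mul_assoc, ← hlayer, ih, pow_succ]
    ring

/-! ## §3 The norm-gated glue count at and above the conductor -/

/-- **THE NORM-GATED GLUE COUNT: for `a ≥ d` and a fixed unit `r`, `#Sol_{2a}(r) = 2·q^a` if `r ∈ N(Kˣ)` and `0` otherwise** (`K` complete, wild place) — the value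
`A(a, ξ) = 2q^a·[ξ ∈ N]` of the wild toric census at and above the conductor (★ Part I §4 + §2 above). [cite: Serre1979, Ch. V §3 Prop. 5, Cor. 2–3 pp. 84–86]
[cite: LabesseLanglands1979, §2 p. 8] -/
theorem natCard_normFibre_eq_two_mul_pow_of_exists [CompleteSpace K] [IsDiscreteValuationRing 𝒪[K]] [Finite 𝓀[K]] (hD : IsRamifiedQuadraticDatum σ ϖ d t)
    (h2v : Valued.v (2 : K) < 1) {r : K} (hr : Valued.v r = 1) (hN : ∃ z : K, z * σ z = r) {a : ℕ} (hda : d ≤ a) :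
    Nat.card {x : 𝒪[K] ⧸ 𝓂[K] ^ (2 * a) // ∃ u : 𝒪[K], Ideal.Quotient.mk (𝓂[K] ^ (2 * a)) u = x ∧ Valued.v ((u : K) * σ u - r) ≤ Valued.v (ϖ ^ (2 * a))} =
      2 * Nat.card 𝓀[K] ^ a := by
  rw [natCard_normFibre_eq_natCard_normFibre_one_of_exists hD.2.1 (2 * a) hr hN]
  exact natCard_normFibre_one_eq_two_mul_pow hD h2v hda

/-- … and `= 0` for a fixed unit that is NOT a norm (★ Part I `natCard_normFibre_eq_zero_of_not_exists` at `n = 2a ≥ 2d − 1`). [cite: Serre1979, Ch. V §3 Cor. 3, Ch. XV §2] -/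
theorem natCard_normFibre_eq_zero_of_not_exists_of_le [CompleteSpace K] (hD : IsRamifiedQuadraticDatum σ ϖ d t)
    {r : K} (hσr : σ r = r) (hr : Valued.v r = 1) (hN : ¬ ∃ z : K, z * σ z = r) {a : ℕ} (hda : d ≤ a) :
    Nat.card {x : 𝒪[K] ⧸ 𝓂[K] ^ (2 * a) // ∃ u : 𝒪[K], Ideal.Quotient.mk (𝓂[K] ^ (2 * a)) u = x ∧ Valued.v ((u : K) * σ u - r) ≤ Valued.v (ϖ ^ (2 * a))} = 0 :=
  natCard_normFibre_eq_zero_of_not_exists hD hσr hr hN (by omega)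

end Literature.NumberTheory.LocalFields.WildQuadraticDatum

end
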